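import Mathlib
import Summits.ValiantsHypothesis.ValiantsHypothesis.Theorems.NewtonUnitEquationsNewtonTauWeakHexagonClasses
import Summits.ValiantsHypothesis.ValiantsHypothesis.Theorems.NewtonUnitEquationsNewtonTauWeakHexagonThree
import Summits.ValiantsHypothesis.ValiantsHypothesis.Theorems.NewtonUnitEquationsNewtonTauWeakHexagonSeparated

/-!
# `NewtonUnitEquationsNewtonTauWeakHexagonClassesBinomial` — the class theorem in T2 shape

Rung toward `stub_binomialNewtonTauCommon` (T2 = KPTT Conj. 1 at `t = 2`; crux `NewtonTauWeak`,
stmt-ValiantsHypothesis-5904), line `binomial-normal-form`, lead c4 (K-UNIFORM three-ray regime): registered stub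
`stub_hexClassesBinomial`.

`stub_hexClassesBinomial`: for a common exponent list `d : Fin N → ℕ²` on the three model rays
`ℕ(1,0) ∪ ℕ(0,1) ∪ ℕ(1,1)` (`hd`) and coefficient rows `ρ l` whose DIAGONAL entries (those `j` with
`(d j) 0 ≠ 0 ≠ (d j) 1`) depend only on the class `cls l < q` of the product (`hρ`), the binomial sum
`Σ_{l<K} c_l Π_j (1 - ρ_{lj} X^{d_j})` has at most `4 + 4q(q+1)(8 + 8·q!·2^{q·q}·K^q)` Newton vertices — polynomial
in the number `K` of products for every fixed number `q` of diagonal classes.  Proof: group the binomial factors of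
each product by ray exactly as in `hex_binomialCommon_rays_allK` (`…HexagonAllKCorollaries`); the diagonal group of
product `l` is the class polynomial `D'_{cls l}` by `hρ`; apply the class theorem `stub_hexClasses`
(`…HexagonClasses`). [folklore: Wronskian method]
-/

set_option linter.dupNamespace false

noncomputable section

namespace Summit.ValiantsHypothesis.ValiantsHypothesis.Theorems.NewtonUnitEquationsNewtonTauWeak

open scoped BigOperators
open MvPolynomial
open Summit.ValiantsHypothesis.ValiantsHypothesis.Theorems.NewtonTauWeak.Negative (vert)

/-- **The class theorem in T2 shape.** For every `K`, every common exponent list inside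
`ℕ(1,0) ∪ ℕ(0,1) ∪ ℕ(1,1)` and coefficient rows whose diagonal entries are determined by the class
`cls l ∈ Fin q` of the product (`ρ l j = ρD (cls l) j` whenever `d j` is strictly diagonal), the binomial sum of `K`
products has at most `4 + 4q(q+1)(8 + 8·q!·2^{q·q}·K^q)` Newton vertices (group factors by ray as in
`hex_binomialCommon_rays_allK`, the diagonal group being the class polynomial; `stub_hexClasses`). [folklore] -/
theorem stub_hexClassesBinomial (K N q : ℕ) (cls : Fin K → Fin q) (c : Fin K → ℂ) (ρ : Fin K → Fin N → ℂ)
    (ρD : Fin q → Fin N → ℂ) (d : Fin N → (Fin 2 →₀ ℕ))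
    (hd : ∀ j, (d j) 1 = 0 ∨ (d j) 0 = 0 ∨ (d j) 0 = (d j) 1)
    (hρ : ∀ l j, (d j) 1 ≠ 0 → (d j) 0 ≠ 0 → ρ l j = ρD (cls l) j) :
    vert (∑ l, C (c l) * ∏ j, (1 - C (ρ l j) * monomial (d j) 1)) ≤
      4 + 4 * q * (q + 1) * (8 + 8 * (Nat.factorial q * 2 ^ (q * q) * K ^ q)) := by
  -- adapted from `hex_binomialCommon_rays_allK` (…HexagonAllKCorollaries.lean): the diagonal group of each product
  -- is indexed by its class, and `stub_hexClasses` replaces `hex_vert_sum_hexagon_le_allK`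
  classical
  set fac : Fin K → Fin N → MvPolynomial (Fin 2) ℂ := fun l j => 1 - C (ρ l j) * monomial (d j) 1
    with hfac
  set px : Fin N → Prop := fun j => (d j) 1 = 0 with hpx
  set py : Fin N → Prop := fun j => (d j) 0 = 0 with hpy
  set X : Fin K → MvPolynomial (Fin 2) ℂ := fun l => C (c l) * ∏ j ∈ Finset.univ.filter px, fac l j
    with hX
  set Y : Fin K → MvPolynomial (Fin 2) ℂ := fun l =>
    ∏ j ∈ (Finset.univ.filter fun j => ¬ px j).filter py, fac l j with hY
  set D' : Fin q → MvPolynomial (Fin 2) ℂ := fun m =>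
    ∏ j ∈ (Finset.univ.filter fun j => ¬ px j).filter (fun j => ¬ py j),
      (1 - C (ρD m j) * monomial (d j) 1) with hD'
  -- on the strictly diagonal exponents the factors of product `l` are those of its class
  have hclass : ∀ l, ∏ j ∈ (Finset.univ.filter fun j => ¬ px j).filter (fun j => ¬ py j), fac l j =
      D' (cls l) := by
    intro l
    simp only [hD']
    refine Finset.prod_congr rfl fun j hj => ?_
    obtain ⟨hj1, hj2⟩ := Finset.mem_filter.mp hj
    have hj1' := (Finset.mem_filter.mp hj1).2
    simp only [hfac]
    rw [hρ l j hj1' hj2]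
  have hsplit : ∀ l, C (c l) * ∏ j, fac l j = X l * Y l * D' (cls l) := by
    intro l
    rw [← hclass l]
    simp only [hX, hY]
    rw [← Finset.prod_filter_mul_prod_filter_not Finset.univ px,
      ← Finset.prod_filter_mul_prod_filter_not (Finset.univ.filter fun j => ¬ px j) py]
    ring
  have hsum : (∑ l, C (c l) * ∏ j, (1 - C (ρ l j) * monomial (d j) 1)) = ∑ l, X l * Y l * D' (cls l) :=
    Finset.sum_congr rfl fun l _ => hsplit l
  rw [hsum]
  have hfx : ∀ l, ∀ j ∈ Finset.univ.filter px, ∀ e ∈ (fac l j).support, e 1 = 0 := by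
    intro l j hj e he
    rcases HexagonThree.mem_support_binomial he with rfl | rfl
    · rfl
    · exact (Finset.mem_filter.mp hj).2
  have hfy : ∀ l, ∀ j ∈ (Finset.univ.filter fun j => ¬ px j).filter py, ∀ e ∈ (fac l j).support,
      e 0 = 0 := by
    intro l j hj e he
    rcases HexagonThree.mem_support_binomial he with rfl | rfl
    · rfl
    · exact (Finset.mem_filter.mp hj).2
  have hfd : ∀ m : Fin q, ∀ j ∈ (Finset.univ.filter fun j => ¬ px j).filter (fun j => ¬ py j),
      ∀ e ∈ (1 - C (ρD m j) * monomial (d j) 1 : MvPolynomial (Fin 2) ℂ).support, e 0 = e 1 := by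
    intro m j hj e he
    rcases HexagonThree.mem_support_binomial he with rfl | rfl
    · rfl
    · obtain ⟨hj1, hj2⟩ := Finset.mem_filter.mp hj
      have hj1' := (Finset.mem_filter.mp hj1).2
      rcases hd j with h | h | h
      · exact absurd h hj1'
      · exact absurd h hj2
      · exact h
  refine stub_hexClasses K q cls X Y D' (fun l => ?_) (fun l => ?_) (fun m => ?_)
  · intro e he
    obtain ⟨a, ha, b, hb, rfl⟩ := Finset.mem_add.mp (support_mul _ _ he)
    rw [← monomial_zero'] at ha
    have ha0 : a = 0 := Finset.mem_singleton.mp (support_monomial_subset ha)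
    have hb1 : b 1 = 0 := HexagonThree.support_prod_induction _ _ (fun e => e 1 = 0) rfl
      (fun p r hp hr => hex_xonly_mul p r hp hr) (hfx l) b hb
    simp [ha0, hb1]
  · exact HexagonThree.support_prod_induction _ _ (fun e => e 0 = 0) rfl
      (fun p r hp hr => hex_yonly_mul p r hp hr) (hfy l)
  · exact HexagonThree.support_prod_induction _ _ (fun e => e 0 = e 1) rfl
      (fun p r hp hr => hex_diag_mul p r hp hr) (hfd m)

end Summit.ValiantsHypothesis.ValiantsHypothesis.Theorems.NewtonUnitEquationsNewtonTauWeak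

end
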